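import Summits.RiemannHypothesis.RiemannHypothesis.Theorems.Splittings.NbLimitCoefficientsConvergence
import HarnessLib

/-!
# Splittings / NB — census row V38 «LIMIT COEFFICIENTS» (file 3 of 3): FINITE-EXCEPTION RIGIDITY — the coefficient law
`c⋆_{N,j} → −μ(j+1)` off ANY finite set of indices `j < K` is already the Riemann Hypothesis; hence RH ⟺ TAIL(K) for every
`K`, RH ⟺ the full coefficient law (the `L²(0,∞)` analogue of Weingartner's theorem), and the index split FIN(K) ∧ TAIL(K)
is a RELABELLING

Cell rh-split, seat rh-split-nb-neg g13 (card `SPLIT-nb-neg.md` §19); continues `Splittings/NbLimitCoefficientsConvergence.lean`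
in the SAME namespace.  Contents (§9): `rh_of_tendsto_nbMinimiser_apply (K)` (T38b) — `(∀ j ≥ K, c⋆_{N,j} → −μ(j+1)) → RH`
[all limits exist by T38a; the exceptional offsets `e_j = γ_j + μ(j+1)`, `j < K`, satisfy `G_K e = 0` by ORTHOGONALITY
(normal equations of `c⋆_N`) + PLATEAU CONVERGENCE of the corrected family `c⋆_N − pad(e)` + Cauchy–Schwarz, so `e = 0`
(`G_K ≻ 0`); then TIGHTNESS `∫_{(0,δ]} (χ − f⋆_N)² ≤ 2∫_{(0,δ]} (χ − f⋆_{N₀})² + 2(d_{N₀}² − d_N²)` + plateau convergence for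
`c⋆_N` give `lim d_N² = 0`]; `riemannHypothesis_iff_tendsto_nbMinimiser_apply_tail (K) : RH ↔ ∀ j ≥ K, …`;
`riemannHypothesis_iff_tendsto_nbMinimiser_apply : RH ↔ ∀ j, …`.

Census reading: TAIL(K) ⟺ RH for every `K` (so TAIL(K) ⟺ TAIL(K′)); FIN(K) is RH-implied (T38c) and a statement about
limits (not finitely certifiable).  No `def`s; standard axioms.  HONEST LABEL: «SPLITTING SEARCH over kernel-typed
RH-EQUIVALENCES; a splitting A ∧ B ⟹ RH is CONDITIONAL bookkeeping unless A and B are both proved; nothing here bears on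
the truth of RH.»
-/

set_option linter.dupNamespace false

noncomputable section

open MeasureTheory Set Finset Filter Topology
open scoped Matrix

namespace Summit.RiemannHypothesis.RiemannHypothesis.Theorems.Splittings.NbLimitCoefficients

open Literature.NumberTheory.LFunctions Literature.NumberTheory.LFunctions.BaezDuarteOnlyIf
open Summit.RiemannHypothesis.RiemannHypothesis.Theorems.NbTheory
open Summit.RiemannHypothesis.RiemannHypothesis.Theorems.NbTheory.GramPosDef
open Summit.RiemannHypothesis.RiemannHypothesis.Theorems.NbTheory.Minimiser
open Summit.RiemannHypothesis.RiemannHypothesis.Theorems.NbTheory.Criterion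
open Summit.RiemannHypothesis.RiemannHypothesis.Theorems.NbTheory.KappaZeroth
open ArithmeticFunction (moebius)

/-! ## §9 (T38b) Finite-exception rigidity: the coefficient law off ANY finite set of indices is RH -/

/-- **(T38b) If `c⋆_{N,j} → −μ(j+1)` for every `j ≥ K`, then the Riemann Hypothesis.**
Proof.  All limits `γ_j` exist (T38a); put `e_j = γ_j + μ(j+1)` (`j < K`) and `v_N = c⋆_N − pad(e)`, a family tending
to Möbius in EVERY coordinate with `d²(v_N) = d_N² + e·G_K e` bounded.  ORTHOGONALITY: `⟨χ − f⋆_N, ρ_{k+1}⟩ = 0`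
(normal equations) gives `(G_K e)_k = ⟨χ − f_{v_N}, ρ_{k+1}⟩`, which tends to `0` by plateau convergence + Cauchy–Schwarz
(`≤ √(B δ) + √(G_kk · ∫_{(δ,∞)} (χ − f_{v_N})²)` for every `δ`); so `G_K e = 0`, `e = 0` (`G_K ≻ 0`): ALL limits are
Möbius.  TIGHTNESS: `∫_{(0,δ]} (χ − f⋆_N)² ≤ 2∫_{(0,δ]}(χ − f⋆_{N₀})² + 2(d_{N₀}² − d_N²)` (pad `c⋆_{N₀}`, complete the
square), so with plateau convergence for `c⋆_N` itself `lim d_N² = 0`, i.e. RH (`riemannHypothesis_iff_tendsto_nbDistSq_nbMinimiser`). -/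
theorem rh_of_tendsto_nbMinimiser_apply (K : ℕ)
    (hK : ∀ j : ℕ, K ≤ j → Tendsto (fun N : ℕ ↦ nbMinimiser (N + (j + 1)) ⟨j, by omega⟩) atTop
      (𝓝 (-(moebius (j + 1) : ℝ)))) : RiemannHypothesis := by
  -- Step 1: all limits exist; the exceptional offsets `e_j = γ_j + μ(j+1)`, `j < K`
  choose γ hγ using tendsto_nbMinimiser_apply
  have hγK : ∀ j, K ≤ j → γ j = -(moebius (j + 1) : ℝ) := fun j hj ↦ tendsto_nhds_unique (hγ j) (hK j hj)
  set e : Fin K → ℝ := fun j ↦ γ j + (moebius ((j : ℕ) + 1) : ℝ) with he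
  -- Step 2: the corrected family `v_N = c⋆_N − pad(e)` tends to Möbius in every coordinate
  set v : (N : ℕ) → (Fin N → ℝ) := fun N k ↦
    nbMinimiser N k - (if h : (k : ℕ) < K then e ⟨k, h⟩ else 0) with hv
  have hvconv : ∀ j : ℕ, Tendsto (fun N : ℕ ↦ if hj : j < N then v N ⟨j, hj⟩ else 0) atTop
      (𝓝 (-(moebius (j + 1) : ℝ))) := by
    intro j
    apply tendsto_dite_of_tendsto_shift
    have h1 := (hγ j).sub_const (if h : j < K then e ⟨j, h⟩ else 0)
    have hval : γ j - (if h : j < K then e ⟨j, h⟩ else 0) = -(moebius (j + 1) : ℝ) := by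
      by_cases hj : j < K
      · rw [dif_pos hj, he]
        ring
      · rw [dif_neg hj, sub_zero]
        exact hγK j (not_lt.1 hj)
    rw [hval] at h1
    exact h1
  -- Step 3: `d²(v_N) = d_N² + e·G_K e ≤ 1 + e·G_K e` for `N ≥ K`
  have hpadQ : ∀ N, K ≤ N →
      (fun k : Fin N ↦ if h : (k : ℕ) < K then e ⟨k, h⟩ else 0) ⬝ᵥ
        (nbGramMatrix N *ᵥ fun k : Fin N ↦ if h : (k : ℕ) < K then e ⟨k, h⟩ else 0) =
      e ⬝ᵥ (nbGramMatrix K *ᵥ e) := by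
    intro N hN
    rw [dotProduct_nbGramMatrix_mulVec, dotProduct_nbGramMatrix_mulVec, dotProduct_nbGram0Matrix_mulVec,
      dotProduct_nbGram0Matrix_mulVec, tailConst_pad e hN]
    congr 1
    refine setIntegral_congr_fun measurableSet_Ioc fun x _ ↦ ?_
    rw [sum_pad_mul_nbRho e hN x]
  have hQe : ∀ N, K ≤ N → nbDistSq N (v N) = nbDistSq N (nbMinimiser N) + e ⬝ᵥ (nbGramMatrix K *ᵥ e) := by
    intro N hN
    have h := nbDistSq_sub_nbDistSq_nbMinimiser (v N)
    have hdiff : v N - nbMinimiser N = -(fun k : Fin N ↦ if h : (k : ℕ) < K then e ⟨k, h⟩ else 0) := by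
      funext k; simp [hv]
    rw [hdiff, Matrix.mulVec_neg, dotProduct_neg, neg_dotProduct, neg_neg, hpadQ N hN] at h
    linarith
  have heQ : 0 ≤ e ⬝ᵥ (nbGramMatrix K *ᵥ e) := by
    have := (nbGramMatrix_posDef K).posSemidef.dotProduct_mulVec_nonneg e
    rwa [star_trivial] at this
  set B : ℝ := 1 + e ⬝ᵥ (nbGramMatrix K *ᵥ e) with hBdef
  have hBnn : 0 ≤ B := by positivity
  have hvB : ∀ᶠ N in atTop, nbDistSq N (v N) ≤ B := by
    filter_upwards [eventually_ge_atTop K] with N hN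
    rw [hQe N hN, hBdef]
    linarith [nbDistSq_nbMinimiser_le_one N]
  -- Step 4: plateau convergence for `v`
  have htail := tendsto_integral_Ioi_sq_approx v hvB hvconv
  -- Step 5: orthogonality ⇒ `G_K e = 0`
  have hX : ∀ k : Fin K, ∑ j : Fin K, nbGram k j * e j = 0 := by
    intro k
    set X := ∑ j : Fin K, nbGram k j * e j with hXdef
    have hXN : ∀ N, K ≤ N → ∫ x in Set.Ioi (0 : ℝ), approx (v N) x * nbRho k x = X := by
      intro N hN
      rw [integral_Ioi_approx_mul_nbRho (v N) k]
      have hne : ∑ j : Fin N, nbGram k j * nbMinimiser N j = nbRhs k := nbMinimiser_normalEq N ⟨k, by omega⟩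
      have h1 : ∑ j : Fin N, nbMinimiser N j * nbGram k j = nbRhs k := by
        rw [← hne]; exact Finset.sum_congr rfl fun j _ ↦ mul_comm _ _
      have h2 : ∑ j : Fin N, (if h : (j : ℕ) < K then e ⟨j, h⟩ else 0) * nbGram k j = X := by
        rw [hXdef, sum_pad_mul e hN (fun i ↦ nbGram k i)]
        exact Finset.sum_congr rfl fun j _ ↦ mul_comm _ _
      simp only [hv, sub_mul, Finset.sum_sub_distrib, h1, h2]
      ring
    have hXle : ∀ M : ℕ, |X| ≤ Real.sqrt (B * (1 / ((M : ℝ) + 1))) := by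
      intro M
      have htM := htail M
      set δ : ℝ := 1 / ((M : ℝ) + 1) with hδdef
      have hδ : 0 < δ := by positivity
      have hlim : Tendsto (fun N ↦ Real.sqrt (B * δ) +
          Real.sqrt (nbGram k k * ∫ x in Set.Ioi δ, approx (v N) x ^ 2)) atTop (𝓝 (Real.sqrt (B * δ))) := by
        have h := ((htM.const_mul (nbGram k k)).sqrt).const_add (Real.sqrt (B * δ))
        rw [mul_zero, Real.sqrt_zero, add_zero] at h
        exact h
      refine ge_of_tendsto hlim ?_
      filter_upwards [eventually_ge_atTop K, hvB] with N hN hBN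
      rw [← hXN N hN]
      have hprod : IntegrableOn (fun x ↦ approx (v N) x * nbRho k x) (Set.Ioi 0) :=
        integrableOn_approx_mul_nbRho (v N) k
      have hsq : IntegrableOn (fun x ↦ approx (v N) x ^ 2) (Set.Ioi 0) := integrableOn_sq_approx (v N)
      have hρ2 : IntegrableOn (fun x ↦ nbRho k x ^ 2) (Set.Ioi 0) := by
        simpa only [sq] using integrableOn_nbRho_mul_nbRho_Ioi_zero k k
      have hA : Set.Ioc 0 δ ⊆ Set.Ioi (0 : ℝ) := Set.Ioc_subset_Ioi_self
      have hB' : Set.Ioi δ ⊆ Set.Ioi (0 : ℝ) := Set.Ioi_subset_Ioi hδ.le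
      rw [← Set.Ioc_union_Ioi_eq_Ioi hδ.le, setIntegral_union Set.Ioc_disjoint_Ioi_same measurableSet_Ioi
        (hprod.mono_set hA) (hprod.mono_set hB')]
      -- head piece: Cauchy–Schwarz against `ρ² ≤ 1`
      have h1 : (∫ x in Set.Ioc 0 δ, approx (v N) x * nbRho k x) ^ 2 ≤ B * δ := by
        have hcs := sq_integral_mul_le (hsq.mono_set hA) (hρ2.mono_set hA) (hprod.mono_set hA)
        have ha : ∫ x in Set.Ioc 0 δ, approx (v N) x ^ 2 ≤ B :=
          (setIntegral_mono_set hsq (ae_of_all _ fun x ↦ sq_nonneg _) (ae_of_all _ hA)).trans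
            ((nbDistSq_eq_integral N (v N)).symm.le.trans hBN)
        have hb : ∫ x in Set.Ioc 0 δ, nbRho k x ^ 2 ≤ δ := by
          have h := norm_setIntegral_le_of_norm_le_const (measure_Ioc_lt_top : volume (Set.Ioc (0 : ℝ) δ) < ⊤)
            (f := fun x ↦ nbRho k x ^ 2) (C := 1) fun x _ ↦ by
              rw [Real.norm_eq_abs, abs_of_nonneg (sq_nonneg _), ← sq_abs]
              exact pow_le_one₀ (abs_nonneg _) (abs_nbRho_le k x)
          rw [Real.norm_eq_abs, measureReal_def, Real.volume_Ioc, sub_zero, ENNReal.toReal_ofReal hδ.le,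
            one_mul] at h
          exact (le_abs_self _).trans h
        calc _ ≤ _ := hcs
          _ ≤ B * δ := mul_le_mul ha hb (integral_nonneg fun x ↦ sq_nonneg _) hBnn
      -- tail piece: Cauchy–Schwarz against `∫_{(δ,∞)} ρ² ≤ G_kk`
      have h2 : (∫ x in Set.Ioi δ, approx (v N) x * nbRho k x) ^ 2 ≤
          nbGram k k * ∫ x in Set.Ioi δ, approx (v N) x ^ 2 := by
        have hcs := sq_integral_mul_le (hsq.mono_set hB') (hρ2.mono_set hB') (hprod.mono_set hB')
        have hb : ∫ x in Set.Ioi δ, nbRho k x ^ 2 ≤ nbGram k k := by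
          refine (setIntegral_mono_set hρ2 (ae_of_all _ fun x ↦ sq_nonneg _) (ae_of_all _ hB')).trans (le_of_eq ?_)
          simp only [nbGram, sq]
        calc _ ≤ _ := hcs
          _ ≤ (∫ x in Set.Ioi δ, approx (v N) x ^ 2) * nbGram k k :=
              mul_le_mul_of_nonneg_left hb (integral_nonneg fun x ↦ sq_nonneg _)
          _ = _ := mul_comm _ _
      exact (abs_add_le _ _).trans (add_le_add (Real.abs_le_sqrt h1) (Real.abs_le_sqrt h2))
    have hlim0 : Tendsto (fun M : ℕ ↦ Real.sqrt (B * (1 / ((M : ℝ) + 1)))) atTop (𝓝 0) := by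
      have h := ((tendsto_one_div_add_atTop_nhds_zero_nat (𝕜 := ℝ)).const_mul B).sqrt
      simpa using h
    exact abs_nonpos_iff.1 (ge_of_tendsto' hlim0 hXle)
  have he0 : e = 0 := by
    by_contra hne
    have hpos := (nbGramMatrix_posDef K).dotProduct_mulVec_pos hne
    rw [star_trivial] at hpos
    have hzero : nbGramMatrix K *ᵥ e = 0 := by
      funext k
      simpa [Matrix.mulVec, dotProduct, nbGramMatrix] using hX k
    rw [hzero, dotProduct_zero] at hpos
    exact lt_irrefl _ hpos
  -- Step 6: hence EVERY limit is Möbius; plateau convergence for `c⋆` itself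
  have hall : ∀ j : ℕ, Tendsto (fun N : ℕ ↦ nbMinimiser (N + (j + 1)) ⟨j, by omega⟩) atTop
      (𝓝 (-(moebius (j + 1) : ℝ))) := by
    intro j
    by_cases hj : j < K
    · have h0 : e ⟨j, hj⟩ = 0 := by rw [he0]; rfl
      simp only [he] at h0
      have : γ j = -(moebius (j + 1) : ℝ) := by linarith
      rw [← this]
      exact hγ j
    · exact hK j (not_lt.1 hj)
  have htail' := tendsto_integral_Ioi_sq_approx (fun N ↦ nbMinimiser N) (B := 1)
    (Eventually.of_forall fun N ↦ nbDistSq_nbMinimiser_le_one N)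
    (fun j ↦ tendsto_dite_of_tendsto_shift (fun N ↦ nbMinimiser N) j (hall j))
  -- Step 7: tightness ⇒ `d_N² → 0`
  set D : ℕ → ℝ := fun N ↦ nbDistSq N (nbMinimiser N) with hDdef
  have hDanti : Antitone D := antitone_nbDistSq_nbMinimiser
  have hDbdd : BddBelow (Set.range D) := ⟨0, by rintro _ ⟨N, rfl⟩; exact (nbDistSq_pos _).le⟩
  set L := ⨅ N, D N with hLdef
  have hDL : Tendsto D atTop (𝓝 L) := tendsto_atTop_ciInf hDanti hDbdd
  have hLle : ∀ N, L ≤ D N := fun N ↦ ciInf_le hDbdd N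
  have hL0 : L ≤ 0 := by
    by_contra hL
    push Not at hL
    set ε := L / 6 with hε
    have hεpos : 0 < ε := by positivity
    -- (a) `N₀` with `d_{N₀}² < L + ε`
    obtain ⟨N₀, hN₀⟩ : ∃ N₀, D N₀ < L + ε := (hDL.eventually (Iio_mem_nhds (by linarith))).exists
    -- (b) `M` with `∫_{(0,δ_M]} (χ − f⋆_{N₀})² < ε`
    have hhead : Tendsto (fun M : ℕ ↦ ∫ x in Set.Ioc (0 : ℝ) (1 / ((M : ℝ) + 1)), approx (nbMinimiser N₀) x ^ 2)
        atTop (𝓝 0) := by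
      have hanti : Antitone (fun M : ℕ ↦ Set.Ioc (0 : ℝ) (1 / ((M : ℝ) + 1))) := by
        intro a b hab
        apply Set.Ioc_subset_Ioc_right
        gcongr
      have h := tendsto_setIntegral_of_antitone (fun M ↦ measurableSet_Ioc) hanti
        ⟨0, (integrableOn_sq_approx (nbMinimiser N₀)).mono_set Set.Ioc_subset_Ioi_self⟩
      have hempty : (⋂ M : ℕ, Set.Ioc (0 : ℝ) (1 / ((M : ℝ) + 1))) = ∅ := by
        ext x
        simp only [Set.mem_iInter, Set.mem_Ioc, Set.mem_empty_iff_false, iff_false, not_forall]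
        by_cases hx : 0 < x
        · obtain ⟨M, hM⟩ := exists_nat_one_div_lt hx
          exact ⟨M, fun h ↦ absurd h.2 (not_le.2 hM)⟩
        · exact ⟨0, fun h ↦ hx h.1⟩
      rw [hempty, Measure.restrict_empty, integral_zero_measure] at h
      exact h
    obtain ⟨M, hM⟩ : ∃ M : ℕ, ∫ x in Set.Ioc (0 : ℝ) (1 / ((M : ℝ) + 1)), approx (nbMinimiser N₀) x ^ 2 < ε :=
      (hhead.eventually (Iio_mem_nhds hεpos)).exists
    -- (c) `N ≥ N₀` with `∫_{(δ_M,∞)} (χ − f⋆_N)² < ε`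
    obtain ⟨N, hNtail, hNN₀⟩ : ∃ N, (∫ x in Set.Ioi (1 / ((M : ℝ) + 1)), approx (nbMinimiser N) x ^ 2) < ε ∧ N₀ ≤ N :=
      (((htail' M).eventually (Iio_mem_nhds hεpos)).and (eventually_ge_atTop N₀)).exists
    -- (d) the head of `χ − f⋆_N` below `δ_M`
    set δ : ℝ := 1 / ((M : ℝ) + 1) with hδdef
    have hδ : 0 < δ := by positivity
    have hδ1 : δ ≤ 1 := by
      rw [hδdef, div_le_one (by positivity)]; linarith [(Nat.cast_nonneg M : (0 : ℝ) ≤ M)]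
    set u : Fin N → ℝ := fun k ↦ (if h : (k : ℕ) < N₀ then nbMinimiser N₀ ⟨k, h⟩ else 0) - nbMinimiser N k with hu
    have hQu : u ⬝ᵥ (nbGramMatrix N *ᵥ u) = D N₀ - D N := by
      have : u = (fun k : Fin N ↦ if h : (k : ℕ) < N₀ then nbMinimiser N₀ ⟨k, h⟩ else 0) - nbMinimiser N := by
        funext k; simp [hu]
      rw [this, ← nbDistSq_sub_nbDistSq_nbMinimiser, nbDistSq_pad _ hNN₀]
    have hpt : ∀ x, approx (nbMinimiser N) x = approx (nbMinimiser N₀) x + ∑ k : Fin N, u k * nbRho k x := by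
      intro x
      rw [← approx_pad (nbMinimiser N₀) hNN₀, approx_eq, approx_eq]
      simp only [hu, sub_mul, Finset.sum_sub_distrib, sum_pad_mul_nbRho _ hNN₀]
      ring
    have hA : Set.Ioc 0 δ ⊆ Set.Ioc (0 : ℝ) 1 := Set.Ioc_subset_Ioc_right hδ1
    have hg2 : IntegrableOn (fun x ↦ (∑ k : Fin N, u k * nbRho k x) ^ 2) (Set.Ioc (0 : ℝ) 1) := by
      have := integrableOn_sq_const_sub u 0
      simpa only [zero_sub, even_two.neg_pow] using this
    have hI1 : IntegrableOn (fun x ↦ 2 * approx (nbMinimiser N₀) x ^ 2) (Set.Ioc 0 δ) :=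
      ((integrableOn_sq_approx _).mono_set (hA.trans Set.Ioc_subset_Ioi_self)).const_mul 2
    have hI2 : IntegrableOn (fun x ↦ 2 * (∑ k : Fin N, u k * nbRho k x) ^ 2) (Set.Ioc 0 δ) :=
      (hg2.mono_set hA).const_mul 2
    have hheadN : ∫ x in Set.Ioc 0 δ, approx (nbMinimiser N) x ^ 2 ≤
        2 * (∫ x in Set.Ioc 0 δ, approx (nbMinimiser N₀) x ^ 2) + 2 * (D N₀ - D N) := by
      have h1 : ∫ x in Set.Ioc 0 δ, approx (nbMinimiser N) x ^ 2 ≤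
          ∫ x in Set.Ioc 0 δ, (2 * approx (nbMinimiser N₀) x ^ 2 + 2 * (∑ k : Fin N, u k * nbRho k x) ^ 2) := by
        refine setIntegral_mono_on ((integrableOn_sq_approx _).mono_set (hA.trans Set.Ioc_subset_Ioi_self))
          (hI1.add hI2) measurableSet_Ioc fun x _ ↦ ?_
        rw [hpt x]
        nlinarith [sq_nonneg (approx (nbMinimiser N₀) x - ∑ k : Fin N, u k * nbRho k x)]
      have h2 : ∫ x in Set.Ioc 0 δ, (∑ k : Fin N, u k * nbRho k x) ^ 2 ≤ D N₀ - D N := by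
        calc ∫ x in Set.Ioc 0 δ, (∑ k : Fin N, u k * nbRho k x) ^ 2
            ≤ ∫ x in Set.Ioc (0 : ℝ) 1, (∑ k : Fin N, u k * nbRho k x) ^ 2 :=
              setIntegral_mono_set hg2 (ae_of_all _ fun x ↦ sq_nonneg _) (ae_of_all _ hA)
          _ ≤ u ⬝ᵥ (nbGramMatrix N *ᵥ u) := by
              rw [dotProduct_nbGramMatrix_mulVec, dotProduct_nbGram0Matrix_mulVec]
              linarith [sq_nonneg (tailConst u)]
          _ = D N₀ - D N := hQu
      rw [integral_add hI1 hI2, integral_const_mul, integral_const_mul] at h1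
      linarith
    -- (e) assemble
    have hsplitN : D N = (∫ x in Set.Ioc 0 δ, approx (nbMinimiser N) x ^ 2) +
        ∫ x in Set.Ioi δ, approx (nbMinimiser N) x ^ 2 := by
      have hint := integrableOn_sq_approx (nbMinimiser N)
      have : D N = nbDistSq N (nbMinimiser N) := rfl
      rw [this, nbDistSq_eq_integral, ← Set.Ioc_union_Ioi_eq_Ioi hδ.le,
        setIntegral_union Set.Ioc_disjoint_Ioi_same measurableSet_Ioi (hint.mono_set Set.Ioc_subset_Ioi_self)
          (hint.mono_set (Set.Ioi_subset_Ioi hδ.le))]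
    have hDN : L ≤ D N := hLle N
    linarith
  have hL : L = 0 := le_antisymm hL0 (le_ciInf fun N ↦ (nbDistSq_pos _).le)
  rw [hL] at hDL
  exact riemannHypothesis_iff_tendsto_nbDistSq_nbMinimiser.2 hDL

/-- **RH ⟺ TAIL(K)** for every `K`: the coefficient law off the first `K` indices is equivalent to the Riemann Hypothesis;
in particular `TAIL(K) ⟺ TAIL(K')` for all `K, K'` — the index split FIN(K) ∧ TAIL(K) of the coefficient law is a
RELABELLING (FIN is RH-implied, TAIL alone is RH). -/
theorem riemannHypothesis_iff_tendsto_nbMinimiser_apply_tail (K : ℕ) :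
    RiemannHypothesis ↔ ∀ j : ℕ, K ≤ j →
      Tendsto (fun N : ℕ ↦ nbMinimiser (N + (j + 1)) ⟨j, by omega⟩) atTop (𝓝 (-(moebius (j + 1) : ℝ))) :=
  ⟨fun h j _ ↦ tendsto_nbMinimiser_apply_of_rh h j, rh_of_tendsto_nbMinimiser_apply K⟩

/-- **The COEFFICIENT LAW in `L²(0,∞)` (the route's analogue of Weingartner's theorem): RH ⟺ `c⋆_{N,j} → −μ(j+1)` for
every `j`.** -/
theorem riemannHypothesis_iff_tendsto_nbMinimiser_apply :
    RiemannHypothesis ↔ ∀ j : ℕ,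
      Tendsto (fun N : ℕ ↦ nbMinimiser (N + (j + 1)) ⟨j, by omega⟩) atTop (𝓝 (-(moebius (j + 1) : ℝ))) :=
  ⟨fun h j ↦ tendsto_nbMinimiser_apply_of_rh h j, fun h ↦ rh_of_tendsto_nbMinimiser_apply 0 fun j _ ↦ h j⟩

end Summit.RiemannHypothesis.RiemannHypothesis.Theorems.Splittings.NbLimitCoefficients

end
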